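import Mathlib
import HarnessLib
import Summits.Ventures.LatticeQCDFlow.Exactness.NCMCGeneralSpaceRestartChainDilution

/-!
# NCMCGeneralSpaceDilutionTotalVariance — the dilution constant is MEASURABLE: by the law of total
# variance along one record out of equilibrium, `Var_{P_F} G = Var_{ν̄₀}(E[G|start]) + E_{ν̄₀}[Var(G|start)]`,
# so `α_G = Var(E[G|start])/Var G = 1 − E[Var(G|start)]/Var G` — replicas launched from the SAME start
# estimate the second term

HONEST FRAMING: exact (Metropolis-corrected) sampling algorithms for lattice gauge theory;
figures of merit are autocorrelation/cost numbers at stated couplings and volumes; no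
continuum-physics claim.

Venture `LatticeQCDFlow` (cell pub-lqcd); FANOUT row 19 (`su2-snf`, GEN-9).  OUR WORK (the law of
total variance, NAMED ONLY, written out for `P_F = κF ∘ₘ ν̄₀` and a bounded record observable); nothing
is cited as a fact.  `Exactness/NCMCGeneralSpaceRestartChainDilution` / `…SampleSizeDilution` /
`…RestartChainAutocorrelationEnvelope` / `Scaling/LaunchIntervalLaw` all consume the START-EXPLAINED
FRACTION `α = Var_{ν̄₀}(E[G | start])/Var_{P_F}(G)` of a record observable's variance (there bounded by
Jensen, `α ≤ 1`, `variance_recordMean_le`).  This file gives the complementary identity that makes `α`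
an equilibrium MEASUREMENT: the within-start variance `E_{ν̄₀}[Var_{κF(z,·)}(G)]` is what `r ≥ 2`
evolutions launched from the same prior configuration estimate, and `α = 1 − (within)/(total)`.

* `integral_sq_sub_recordMean` — `∫ (G − h z)² dκF(z,·) = ∫ G² dκF(z,·) − h(z)²` (`h(z) = ∫ G dκF(z,·)`);
* **`CrooksPair.variance_fwdPathLaw_eq_add`** — THE LAW OF TOTAL VARIANCE for `P_F`:
  `Var_{P_F} G = Var_{ν̄₀} h + ∫ (∫ (G − h z)² dκF(z,·)) dν̄₀(z)`;
* `CrooksPair.dilution_eq_one_sub` — for `Var_{P_F} G ≠ 0`: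
  `Var_{ν̄₀} h / Var_{P_F} G = 1 − (∫∫ (G − h z)² dκF dν̄₀)/Var_{P_F} G`.

Reading (value-free; P23 for the write-up): for the Jarzynski functional `G = e^{ΔF̂ − W}` (truncated),
launch `r` replicas from each of `K` prior configurations; `α̂ = 1 − (mean within-start sample variance)/(pooled variance)`
estimates the dilution constant the sample-size and launch-interval laws need; combined with the lag-1
weight autocorrelation (`≤ α·q^{n_between}`, `…AutocorrelationEnvelope`) it separates `α` from `q^{n_between}`.
NOT CLAIMED: estimator properties (bias of the ratio), numbers.
-/

namespace Summit.Ventures.LatticeQCDFlow.Exactness.GeneralNCMC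

open MeasureTheory ProbabilityTheory Set Filter Finset
open scoped ENNReal

variable {Ω E : Type*} [MeasurableSpace Ω] [MeasurableSpace E]

/-- `∫ (G − h z)² dκF(z, ·) = ∫ G² dκF(z, ·) − h(z)²` for a bounded measurable `G` and a Markov `κF`
(`h(z) = ∫ G dκF(z, ·)`). -/
theorem integral_sq_sub_recordMean (κF : Kernel Ω E) [IsMarkovKernel κF] {G : E → ℝ}
    (hG : Measurable G) {C : ℝ} (hC : ∀ ω, |G ω| ≤ C) (z : Ω) :
    ∫ ω, (G ω - ∫ ω', G ω' ∂(κF z)) ^ 2 ∂(κF z)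
      = ∫ ω, G ω ^ 2 ∂(κF z) - (∫ ω', G ω' ∂(κF z)) ^ 2 := by
  set m := ∫ ω', G ω' ∂(κF z) with hm
  have hint : Integrable G (κF z) := Scoring.integrable_of_bounded _ hG hC
  have hint2 : Integrable (fun ω => G ω ^ 2) (κF z) :=
    Scoring.integrable_of_bounded _ (hG.pow_const 2) (C := C ^ 2) fun ω => by
      rw [abs_pow]; exact pow_le_pow_left₀ (abs_nonneg _) (hC ω) 2
  have hexp : (fun ω => (G ω - m) ^ 2) = fun ω => G ω ^ 2 - (2 * m) * G ω + m ^ 2 := by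
    funext ω; ring
  rw [hexp, integral_add ?_ (integrable_const _), integral_sub hint2 (hint.const_mul _),
    integral_const_mul, integral_const, probReal_univ, one_smul]
  · ring
  · exact hint2.sub (hint.const_mul _)

namespace CrooksPair

variable {ν₀ ν₁ : Measure Ω} [IsFiniteMeasure ν₀] [IsFiniteMeasure ν₁] {κF κR : Kernel Ω E}
  [IsMarkovKernel κF] [IsMarkovKernel κR] {s e : E → Ω} {W : E → ℝ}

omit [IsFiniteMeasure ν₁] [IsMarkovKernel κR] in
/-- **THE LAW OF TOTAL VARIANCE FOR ONE RECORD OUT OF EQUILIBRIUM**: for a bounded measurable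
record observable `G`, with `h(z) = ∫ G dκF(z, ·)` and `ν̄₀ = Z₀⁻¹ν₀` (`Z₀ ≠ 0`):
`Var_{P_F} G = Var_{ν̄₀} h + ∫ (∫ (G − h z)² dκF(z, ·)) dν̄₀(z)` — between-start plus within-start. [ours] -/
theorem variance_fwdPathLaw_eq_add (h0 : ν₀ univ ≠ 0) {G : E → ℝ} (hG : Measurable G) {C : ℝ}
    (hC : ∀ ω, |G ω| ≤ C) :
    Var[G; fwdPathLaw ν₀ κF]
      = Var[fun z => ∫ ω, G ω ∂(κF z); (ν₀ univ)⁻¹ • ν₀]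
        + ∫ z, (∫ ω, (G ω - ∫ ω', G ω' ∂(κF z)) ^ 2 ∂(κF z)) ∂((ν₀ univ)⁻¹ • ν₀) := by
  haveI := isProbabilityMeasure_fwdPathLaw ν₀ h0 κF
  haveI : IsProbabilityMeasure ((ν₀ univ)⁻¹ • ν₀) := by
    constructor
    rw [Measure.smul_apply, smul_eq_mul, ENNReal.inv_mul_cancel h0 (measure_ne_top _ _)]
  set π₀ := (ν₀ univ)⁻¹ • ν₀ with hπ₀
  set θ := ∫ ω, G ω ∂(fwdPathLaw ν₀ κF) with hθ
  have hhm := measurable_recordMean κF hG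
  have hhb := abs_recordMean_le κF hC
  have hC0 : 0 ≤ C := (abs_nonneg _).trans (hhb (Classical.choice (by
    by_contra hne
    rw [not_nonempty_iff] at hne
    exact h0 (by rw [Set.univ_eq_empty_iff.2 hne, measure_empty]))))
  have hmean : ∫ z, (∫ ω, G ω ∂(κF z)) ∂π₀ = θ := integral_recordMean_fwdPathLaw hG hC
  -- total variance as an iterated integral
  have hcm : Measurable fun ω => (G ω - θ) ^ 2 := (hG.sub measurable_const).pow_const 2
  have hcb : ∀ ω, |(G ω - θ) ^ 2| ≤ (C + |θ|) ^ 2 := fun ω => by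
    rw [abs_pow]
    exact pow_le_pow_left₀ (abs_nonneg _) ((abs_sub _ _).trans (add_le_add (hC ω) le_rfl)) 2
  have htot : Var[G; fwdPathLaw ν₀ κF] = ∫ z, ∫ ω, (G ω - θ) ^ 2 ∂(κF z) ∂π₀ := by
    rw [variance_eq_integral hG.aemeasurable]
    exact integral_fwdPathLaw_eq_integral_integral ν₀ κF hcm hcb
  -- the fibrewise split `∫ (G − θ)² dκF z = ∫ (G − h z)² dκF z + (h z − θ)²`
  have hfib : ∀ z, ∫ ω, (G ω - θ) ^ 2 ∂(κF z)
      = ∫ ω, (G ω - ∫ ω', G ω' ∂(κF z)) ^ 2 ∂(κF z) + (∫ ω', G ω' ∂(κF z) - θ) ^ 2 := by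
    intro z
    have hint : Integrable G (κF z) := Scoring.integrable_of_bounded _ hG hC
    have hint2 : Integrable (fun ω => G ω ^ 2) (κF z) :=
      Scoring.integrable_of_bounded _ (hG.pow_const 2) (C := C ^ 2) fun ω => by
        rw [abs_pow]; exact pow_le_pow_left₀ (abs_nonneg _) (hC ω) 2
    rw [integral_sq_sub_recordMean κF hG hC z]
    have hexp : (fun ω => (G ω - θ) ^ 2) = fun ω => G ω ^ 2 - (2 * θ) * G ω + θ ^ 2 := by
      funext ω; ring
    rw [hexp, integral_add ?_ (integrable_const _), integral_sub hint2 (hint.const_mul _),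
      integral_const_mul, integral_const, probReal_univ, one_smul]
    · ring
    · exact hint2.sub (hint.const_mul _)
  -- the between-start term is `Var_{π₀} h`
  have hbet : ∫ z, (∫ ω', G ω' ∂(κF z) - θ) ^ 2 ∂π₀ = Var[fun z => ∫ ω, G ω ∂(κF z); π₀] := by
    rw [variance_eq_integral hhm.aemeasurable]
    refine integral_congr_ae (Eventually.of_forall fun z => ?_)
    simp only
    rw [hmean]
  -- integrability of the two fibre terms in `z`
  have hwm : Measurable fun z => ∫ ω, (G ω - ∫ ω', G ω' ∂(κF z)) ^ 2 ∂(κF z) := by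
    have h1 : Measurable fun z => ∫ ω, G ω ^ 2 ∂(κF z) := measurable_recordMean κF (hG.pow_const 2)
    have heq : (fun z => ∫ ω, (G ω - ∫ ω', G ω' ∂(κF z)) ^ 2 ∂(κF z))
        = fun z => ∫ ω, G ω ^ 2 ∂(κF z) - (∫ ω', G ω' ∂(κF z)) ^ 2 :=
      funext fun z => integral_sq_sub_recordMean κF hG hC z
    rw [heq]
    exact h1.sub (hhm.pow_const 2)
  have hwb : ∀ z, |∫ ω, (G ω - ∫ ω', G ω' ∂(κF z)) ^ 2 ∂(κF z)| ≤ (C + C) ^ 2 := fun z => by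
    rw [abs_of_nonneg (integral_nonneg fun ω => sq_nonneg _)]
    calc ∫ ω, (G ω - ∫ ω', G ω' ∂(κF z)) ^ 2 ∂(κF z) ≤ ∫ _ω, (C + C) ^ 2 ∂(κF z) :=
          integral_mono_of_nonneg (Eventually.of_forall fun ω => sq_nonneg _) (integrable_const _)
            (Eventually.of_forall fun ω => by
              show (G ω - ∫ ω', G ω' ∂(κF z)) ^ 2 ≤ (C + C) ^ 2
              have hb : |G ω - ∫ ω', G ω' ∂(κF z)| ≤ C + C :=
                (abs_sub _ _).trans (add_le_add (hC ω) (hhb z))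
              calc (G ω - ∫ ω', G ω' ∂(κF z)) ^ 2 = |G ω - ∫ ω', G ω' ∂(κF z)| ^ 2 := (sq_abs _).symm
                _ ≤ (C + C) ^ 2 := pow_le_pow_left₀ (abs_nonneg _) hb 2)
      _ = (C + C) ^ 2 := by rw [integral_const, probReal_univ, one_smul]
  have hbm : Measurable fun z => (∫ ω', G ω' ∂(κF z) - θ) ^ 2 := (hhm.sub measurable_const).pow_const 2
  have hbb : ∀ z, |(∫ ω', G ω' ∂(κF z) - θ) ^ 2| ≤ (C + |θ|) ^ 2 := fun z => by
    rw [abs_pow]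
    exact pow_le_pow_left₀ (abs_nonneg _) ((abs_sub _ _).trans (add_le_add (hhb z) le_rfl)) 2
  rw [htot, integral_congr_ae (Eventually.of_forall hfib), integral_add
    (Scoring.integrable_of_bounded _ hwm hwb) (Scoring.integrable_of_bounded _ hbm hbb), hbet]
  ring

omit [IsFiniteMeasure ν₁] [IsMarkovKernel κR] in
/-- **The dilution constant as one minus the within-start fraction**: for `Var_{P_F} G ≠ 0`,
`Var_{ν̄₀}(E[G|start])/Var_{P_F} G = 1 − E_{ν̄₀}[Var(G|start)]/Var_{P_F} G`. [ours] -/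
theorem dilution_eq_one_sub (h0 : ν₀ univ ≠ 0) {G : E → ℝ} (hG : Measurable G) {C : ℝ}
    (hC : ∀ ω, |G ω| ≤ C) (hV : Var[G; fwdPathLaw ν₀ κF] ≠ 0) :
    Var[fun z => ∫ ω, G ω ∂(κF z); (ν₀ univ)⁻¹ • ν₀] / Var[G; fwdPathLaw ν₀ κF]
      = 1 - (∫ z, (∫ ω, (G ω - ∫ ω', G ω' ∂(κF z)) ^ 2 ∂(κF z)) ∂((ν₀ univ)⁻¹ • ν₀))
          / Var[G; fwdPathLaw ν₀ κF] := by
  have h := variance_fwdPathLaw_eq_add (κF := κF) h0 hG hC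
  rw [eq_sub_iff_add_eq, ← add_div, ← h, div_self hV]

end CrooksPair

end Summit.Ventures.LatticeQCDFlow.Exactness.GeneralNCMC
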